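/-
Copyright (c) 2026 the pub-hodgecm-mathlib formalisation cell (harness21).  Prover seat hodgecm-mathlib-K2E3-p25 (g0), HCML Track B «K2-LIT»,
h413 = `stmt-HodgeConjecture-24833`, line `K2_E3_EllipticInputs`, road (11-3-split-nsc), leaf (nsc-S-A′) `sig_K2E3GL3PrincipalBlockStandardSpan`,
brick E1 «EXPONENT MULTISET» of the leaf owner's architecture memo `K2/K2E3-p25/g0/MEMO-SA-architecture.v1.K2E3-p25-g0.md`.  2026-09-04.
-/
import Mathlib.LinearAlgebra.Eigenspace.Pi
import Mathlib.LinearAlgebra.Eigenspace.Triangularizable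
import Mathlib.LinearAlgebra.FiniteDimensional.Lemmas
import Mathlib.RepresentationTheory.Basic
import Mathlib.Analysis.Complex.Polynomial.Basic
import HarnessLib

/-!
# K2_E3 road (h413), leaf (nsc-S-A′), brick E1 — the EXPONENT MULTISET of a finite-dimensional representation of a commutative group:
# simultaneous generalised eigenspaces, their behaviour under equivariant maps, and ADDITIVITY OF MULTIPLICITIES along short exact sequences

Cell `pub/hodgecm-mathlib` (D-0151), Track B, seat K2E3-p25 (g0) = owner of the leaf (nsc-S-A′) «principal-block standard span for `GL₃(F)`»
(`K2/STATUS.md` 2026-09-04 08:17Z ∕ 08:29Z).  `--supports stmt-HodgeConjecture-24833 --as helper`; THEOREMS ONLY (no definition ∕ instance ∕ notation ∕ named fact ∕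
`sorry`); generic linear algebra, never imports `Cruxes/…/Lines`.  COUNT-NEUTRAL.

THE MATHEMATICS ([Casselman1995, §4.4 p. 45 «`(V_N)_{χ,∞}`»]; [BernsteinZelevinsky1977, §2.3, Cor. 2.13 (c)]; [Waldspurger2003, III.1]).  Let a group `M` act on a
finite-dimensional complex vector space `W` through PAIRWISE COMMUTING operators `τ(m)` (e.g. `M` commutative — the Levi `T = (F×)ⁿ` of a minimal parabolic of
`GL_n(F)` acting on a Jacquet module).  For a function `χ : M → ℂ` the **`χ`-weight space** is the simultaneous generalised eigenspace
`W_χ = ⋂_m ⋃_k ker (τ(m) − χ(m))^k` (Mathlib `⨅ m, Module.End.maxGenEigenspace (τ m) (χ m)`; written INLINE throughout — no definition is introduced), and the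
**multiplicity of the exponent `χ`** is `dim W_χ`.  Then:
* §1 `W = ⊕_χ W_χ` (Mathlib: independence `Module.End.independent_iInf_maxGenEigenspace_of_forall_mapsTo`, spanning over the algebraically closed field `ℂ`
  `Module.End.iSup_iInf_maxGenEigenspace_eq_top_of_iSup_maxGenEigenspace_eq_top_of_commute`); so `W_χ` and `⨆_{χ′ ≠ χ} W_{χ′}` are complements
  (`isCompl_weightSpace_biSup_ne`);
* §2 an `M`-equivariant linear map sends `W_χ` into `W′_χ` (`map_weightSpace_le`), an injective one reflects membership (`mem_weightSpace_iff_of_injective`), a surjective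
  one maps `W_χ` ONTO `W′_χ` (`map_weightSpace_eq_of_surjective` — decompose a preimage along §1);
* §3 **ADDITIVITY**: along an `M`-equivariant short exact sequence `0 → W₁ → W₂ → W₃ → 0` of finite-dimensional spaces, `dim (W₂)_χ = dim (W₁)_χ + dim (W₃)_χ` for every `χ`
  (`finrank_weightSpace_eq_add_of_exact`) — the multiset of exponents of the middle is the sum of the outer two [Waldspurger2003, III.1; BernsteinZelevinsky1977, Cor. 2.13];
  corollaries: monotonicity under injections ∕ surjections, invariance under equivariant isomorphisms;
* (sequel `K2E3JacquetExponentEigenvector`: common eigenvectors ∕ equivariant functionals on a non-zero weight space, twists, one-dimensional characters.)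
This is the bookkeeping layer («exponent calculus») of the leaf's route «EXP» (memo §1, facts (X3)); the Jacquet-module instances (`T`-module `r_B V` for `V` of finite
length on `GL₃(F)`, ★ exactness `jacquet_exact_holds`) are one-line applications made in the consuming files.

HONEST LABEL: HC_CM is proved only modulo the 7 printed citations (2 remaining named inputs: hLiu418 = stmt-HodgeConjecture-24832, h413 = stmt-HodgeConjecture-24833) until rung 0
closes; count-neutral generic helper.

## References
* [Casselman1995] W. Casselman, *Introduction to the theory of admissible representations of p-adic reductive groups* (draft 1 May 1995), §4.4 p. 45, §6.3, §7.1.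
* [BernsteinZelevinsky1977] I. N. Bernstein, A. V. Zelevinsky, *Induced representations of reductive p-adic groups I*, Ann. Sci. ÉNS 10 (1977), §2.3, Cor. 2.13.
* [Waldspurger2003] J.-L. Waldspurger, *La formule de Plancherel pour les groupes p-adiques (d'après Harish-Chandra)*, J. Inst. Math. Jussieu 2 (2003), III.1.
-/

set_option autoImplicit false
set_option linter.dupNamespace false

noncomputable section

open Module Module.End Set Function

namespace Summit.HodgeConjecture.HodgeConjecture.Cruxes.H413.K2E3JacquetExponentMultiset

universe u v

variable {M : Type u} [Group M]
variable {W : Type v} [AddCommGroup W] [Module ℂ W]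
variable {W₁ : Type v} [AddCommGroup W₁] [Module ℂ W₁]
variable {W₂ : Type v} [AddCommGroup W₂] [Module ℂ W₂]
variable {W₃ : Type v} [AddCommGroup W₃] [Module ℂ W₃]

/-! ## §0 Equivariant maps commute with the polynomials `(τ(m) − c)^k` -/

/-- An equivariant linear map intertwines `(τ₁(m) − c)^k` and `(τ₂(m) − c)^k`. [folklore] -/
theorem map_pow_sub_smul_apply (τ₁ : Representation ℂ M W₁) (τ₂ : Representation ℂ M W₂) (f : W₁ →ₗ[ℂ] W₂)
    (hf : ∀ m v, f (τ₁ m v) = τ₂ m (f v)) (m : M) (c : ℂ) (k : ℕ) (v : W₁) :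
    f (((τ₁ m - c • (1 : Module.End ℂ W₁)) ^ k) v) = ((τ₂ m - c • (1 : Module.End ℂ W₂)) ^ k) (f v) := by
  induction k generalizing v with
  | zero => simp
  | succ k ih =>
    rw [pow_succ, pow_succ, Module.End.mul_apply, Module.End.mul_apply, ih]
    congr 1
    simp only [LinearMap.sub_apply, LinearMap.smul_apply, Module.End.one_apply, map_sub, map_smul, hf]

/-! ## §1 The weight-space decomposition `W = ⊕_χ W_χ` for pairwise commuting operators -/

/-- Each `τ(m)` preserves every generalised eigenspace of every `τ(m′)` when the operators commute. [folklore] -/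
theorem mapsTo_maxGenEigenspace_of_forall_commute (τ : Representation ℂ M W) (hτ : ∀ m m' : M, Commute (τ m) (τ m'))
    (m m' : M) (φ : ℂ) : MapsTo (τ m) (Module.End.maxGenEigenspace (τ m') φ) (Module.End.maxGenEigenspace (τ m') φ) :=
  Module.End.mapsTo_maxGenEigenspace_of_comm (hτ m' m) φ

/-- **Independence of the weight spaces**: the family `χ ↦ W_χ` is independent (`iSupIndep`). [folklore] -/
theorem iSupIndep_weightSpace (τ : Representation ℂ M W) (hτ : ∀ m m' : M, Commute (τ m) (τ m')) :
    iSupIndep fun χ : M → ℂ => ⨅ m, Module.End.maxGenEigenspace (τ m) (χ m) :=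
  Module.End.independent_iInf_maxGenEigenspace_of_forall_mapsTo (fun m => τ m)
    (fun m m' φ => mapsTo_maxGenEigenspace_of_forall_commute τ hτ m m' φ)

/-- **The weight spaces span** a finite-dimensional `W` (the field `ℂ` is algebraically closed). [folklore] -/
theorem iSup_weightSpace_eq_top (τ : Representation ℂ M W) [FiniteDimensional ℂ W] (hτ : ∀ m m' : M, Commute (τ m) (τ m')) :
    ⨆ χ : M → ℂ, ⨅ m, Module.End.maxGenEigenspace (τ m) (χ m) = ⊤ :=
  Module.End.iSup_iInf_maxGenEigenspace_eq_top_of_iSup_maxGenEigenspace_eq_top_of_commute (fun m => τ m)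
    (fun m m' _ => hτ m m') (fun m => Module.End.iSup_maxGenEigenspace_eq_top (τ m))

/-- `W_χ` and the sum of the other weight spaces are COMPLEMENTARY subspaces. [folklore] -/
theorem isCompl_weightSpace_biSup_ne (τ : Representation ℂ M W) [FiniteDimensional ℂ W] (hτ : ∀ m m' : M, Commute (τ m) (τ m')) (χ : M → ℂ) :
    IsCompl (⨅ m, Module.End.maxGenEigenspace (τ m) (χ m)) (⨆ (χ' : M → ℂ) (_ : χ' ≠ χ), ⨅ m, Module.End.maxGenEigenspace (τ m) (χ' m)) := by
  refine ⟨iSupIndep_weightSpace τ hτ χ, ?_⟩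
  rw [codisjoint_iff, ← iSup_split_single (fun χ' : M → ℂ => ⨅ m, Module.End.maxGenEigenspace (τ m) (χ' m)) χ]
  exact iSup_weightSpace_eq_top τ hτ

/-- Each `τ(m)` preserves each weight space. [folklore] -/
theorem apply_mem_weightSpace (τ : Representation ℂ M W) (hτ : ∀ m m' : M, Commute (τ m) (τ m')) (χ : M → ℂ) (m₀ : M)
    {v : W} (hv : v ∈ ⨅ m, Module.End.maxGenEigenspace (τ m) (χ m)) : τ m₀ v ∈ ⨅ m, Module.End.maxGenEigenspace (τ m) (χ m) := by
  rw [Submodule.mem_iInf] at hv ⊢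
  exact fun m => mapsTo_maxGenEigenspace_of_forall_commute τ hτ m₀ m (χ m) (hv m)

/-! ## §2 Weight spaces under equivariant maps -/

/-- An equivariant map sends `W_χ` into `W′_χ`. [cite: BernsteinZelevinsky1977, §2.3] -/
theorem map_weightSpace_le (τ₁ : Representation ℂ M W₁) (τ₂ : Representation ℂ M W₂) (f : W₁ →ₗ[ℂ] W₂)
    (hf : ∀ m v, f (τ₁ m v) = τ₂ m (f v)) (χ : M → ℂ) :
    (⨅ m, Module.End.maxGenEigenspace (τ₁ m) (χ m)).map f ≤ ⨅ m, Module.End.maxGenEigenspace (τ₂ m) (χ m) := by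
  rintro _ ⟨v, hv, rfl⟩
  have hv' : ∀ m, v ∈ Module.End.maxGenEigenspace (τ₁ m) (χ m) := (Submodule.mem_iInf _).1 hv
  refine (Submodule.mem_iInf _).2 fun m => ?_
  obtain ⟨k, hk⟩ := (Module.End.mem_maxGenEigenspace _ _ _).1 (hv' m)
  exact (Module.End.mem_maxGenEigenspace _ _ _).2 ⟨k, by rw [← map_pow_sub_smul_apply τ₁ τ₂ f hf, hk, map_zero]⟩

/-- Pointwise form of `map_weightSpace_le`. [cite: BernsteinZelevinsky1977, §2.3] -/
theorem apply_mem_weightSpace_of_mem (τ₁ : Representation ℂ M W₁) (τ₂ : Representation ℂ M W₂) (f : W₁ →ₗ[ℂ] W₂)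
    (hf : ∀ m v, f (τ₁ m v) = τ₂ m (f v)) (χ : M → ℂ) {v : W₁} (hv : v ∈ ⨅ m, Module.End.maxGenEigenspace (τ₁ m) (χ m)) :
    f v ∈ ⨅ m, Module.End.maxGenEigenspace (τ₂ m) (χ m) :=
  map_weightSpace_le τ₁ τ₂ f hf χ ⟨v, hv, rfl⟩

/-- An INJECTIVE equivariant map reflects weight-space membership. [cite: BernsteinZelevinsky1977, §2.3] -/
theorem mem_weightSpace_iff_of_injective (τ₁ : Representation ℂ M W₁) (τ₂ : Representation ℂ M W₂) (f : W₁ →ₗ[ℂ] W₂)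
    (hf : ∀ m v, f (τ₁ m v) = τ₂ m (f v)) (hinj : Injective f) (χ : M → ℂ) (v : W₁) :
    v ∈ ⨅ m, Module.End.maxGenEigenspace (τ₁ m) (χ m) ↔ f v ∈ ⨅ m, Module.End.maxGenEigenspace (τ₂ m) (χ m) := by
  refine ⟨apply_mem_weightSpace_of_mem τ₁ τ₂ f hf χ, fun hv => ?_⟩
  rw [Submodule.mem_iInf] at hv ⊢
  intro m
  obtain ⟨k, hk⟩ := (Module.End.mem_maxGenEigenspace _ _ _).1 (hv m)
  refine (Module.End.mem_maxGenEigenspace _ _ _).2 ⟨k, hinj ?_⟩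
  rw [map_pow_sub_smul_apply τ₁ τ₂ f hf, hk, map_zero]

/-- An equivariant map sends the complement `⨆_{χ′ ≠ χ} W_{χ′}` into the corresponding complement. [folklore] -/
theorem map_biSup_ne_weightSpace_le (τ₁ : Representation ℂ M W₁) (τ₂ : Representation ℂ M W₂) (f : W₁ →ₗ[ℂ] W₂)
    (hf : ∀ m v, f (τ₁ m v) = τ₂ m (f v)) (χ : M → ℂ) :
    (⨆ (χ' : M → ℂ) (_ : χ' ≠ χ), ⨅ m, Module.End.maxGenEigenspace (τ₁ m) (χ' m)).map f ≤
      ⨆ (χ' : M → ℂ) (_ : χ' ≠ χ), ⨅ m, Module.End.maxGenEigenspace (τ₂ m) (χ' m) := by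
  simp only [Submodule.map_iSup]
  exact iSup₂_mono fun χ' _ => map_weightSpace_le τ₁ τ₂ f hf χ'

/-- **A SURJECTIVE equivariant map maps `W_χ` ONTO `W′_χ`** (source finite-dimensional): decompose a preimage `x = x_χ + x'` along `W₁ = (W₁)_χ ⊕ ⨆_{χ′≠χ}(W₁)_{χ′}`;
the image of `x'` lies in the complement of `(W₂)_χ`, so it vanishes. [cite: BernsteinZelevinsky1977, Cor. 2.13 (c)] [folklore] -/
theorem map_weightSpace_eq_of_surjective (τ₁ : Representation ℂ M W₁) (τ₂ : Representation ℂ M W₂) [FiniteDimensional ℂ W₁]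
    (h₁ : ∀ m m' : M, Commute (τ₁ m) (τ₁ m')) (h₂ : ∀ m m' : M, Commute (τ₂ m) (τ₂ m'))
    (g : W₁ →ₗ[ℂ] W₂) (hg : ∀ m v, g (τ₁ m v) = τ₂ m (g v)) (hsurj : Surjective g) (χ : M → ℂ) :
    (⨅ m, Module.End.maxGenEigenspace (τ₁ m) (χ m)).map g = ⨅ m, Module.End.maxGenEigenspace (τ₂ m) (χ m) := by
  haveI : FiniteDimensional ℂ W₂ := Module.Finite.of_surjective g hsurj
  refine le_antisymm (map_weightSpace_le τ₁ τ₂ g hg χ) fun z hz => ?_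
  obtain ⟨x, rfl⟩ := hsurj z
  -- decompose `x` along `(W₁)_χ ⊕ C₁`
  have hc₁ := isCompl_weightSpace_biSup_ne τ₁ h₁ χ
  obtain ⟨y, hy, y', hy', rfl⟩ := Submodule.mem_sup.1 (hc₁.sup_eq_top.symm ▸ Submodule.mem_top (x := x))
  have hgy : g y ∈ ⨅ m, Module.End.maxGenEigenspace (τ₂ m) (χ m) := apply_mem_weightSpace_of_mem τ₁ τ₂ g hg χ hy
  have hgy' : g y' ∈ ⨆ (χ' : M → ℂ) (_ : χ' ≠ χ), ⨅ m, Module.End.maxGenEigenspace (τ₂ m) (χ' m) :=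
    map_biSup_ne_weightSpace_le τ₁ τ₂ g hg χ ⟨y', hy', rfl⟩
  -- `g y' ∈ (W₂)_χ ∩ C₂ = 0`
  have hgy'χ : g y' ∈ ⨅ m, Module.End.maxGenEigenspace (τ₂ m) (χ m) := by
    have : g y' = g (y + y') - g y := by rw [map_add, add_sub_cancel_left]
    rw [this]
    exact Submodule.sub_mem _ hz hgy
  have hzero : g y' = 0 := by
    have hc₂ := isCompl_weightSpace_biSup_ne τ₂ h₂ χ
    have hmem : g y' ∈ (⨅ m, Module.End.maxGenEigenspace (τ₂ m) (χ m)) ⊓ ⨆ (χ' : M → ℂ) (_ : χ' ≠ χ), ⨅ m, Module.End.maxGenEigenspace (τ₂ m) (χ' m) :=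
      ⟨hgy'χ, hgy'⟩
    rwa [hc₂.inf_eq_bot, Submodule.mem_bot] at hmem
  refine ⟨y, hy, ?_⟩
  rw [map_add, hzero, add_zero]

/-! ## §3 Additivity of multiplicities along equivariant short exact sequences -/

/-- Along an exact `W₁ →ᶠ W₂ →ᵍ W₃` with `f` injective, the kernel of `g` on `(W₂)_χ` is `f((W₁)_χ)`. [cite: BernsteinZelevinsky1977, Cor. 2.13 (c)] -/
theorem weightSpace_inf_ker_eq_map (τ₁ : Representation ℂ M W₁) (τ₂ : Representation ℂ M W₂) (τ₃ : Representation ℂ M W₃)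
    (f : W₁ →ₗ[ℂ] W₂) (g : W₂ →ₗ[ℂ] W₃) (hf : ∀ m v, f (τ₁ m v) = τ₂ m (f v)) (hinj : Injective f) (hfg : Exact f g) (χ : M → ℂ) :
    (⨅ m, Module.End.maxGenEigenspace (τ₂ m) (χ m)) ⊓ LinearMap.ker g = (⨅ m, Module.End.maxGenEigenspace (τ₁ m) (χ m)).map f := by
  -- `τ₃` only enters through the statement's symmetry; the kernel computation uses `f` and exactness
  let _ := τ₃
  refine le_antisymm ?_ ?_
  · rintro x ⟨hx, hxk⟩
    obtain ⟨y, rfl⟩ := (hfg x).1 (LinearMap.mem_ker.1 hxk)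
    exact ⟨y, (mem_weightSpace_iff_of_injective τ₁ τ₂ f hf hinj χ y).2 hx, rfl⟩
  · rintro _ ⟨y, hy, rfl⟩
    exact ⟨apply_mem_weightSpace_of_mem τ₁ τ₂ f hf χ hy, LinearMap.mem_ker.2 ((hfg (f y)).2 ⟨y, rfl⟩)⟩

/-- **ADDITIVITY OF EXPONENT MULTIPLICITIES.**  For pairwise commuting actions and an `M`-equivariant short exact sequence `0 → W₁ →ᶠ W₂ →ᵍ W₃ → 0` with `W₂`
finite-dimensional: `dim (W₂)_χ = dim (W₁)_χ + dim (W₃)_χ` for every `χ : M → ℂ` (rank–nullity for `g|_{(W₂)_χ}`, whose kernel is `f((W₁)_χ) ≅ (W₁)_χ` and whose image is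
all of `(W₃)_χ` by `map_weightSpace_eq_of_surjective`).  This is «the exponents of the middle term, with multiplicity, are those of the ends».
[cite: BernsteinZelevinsky1977, Cor. 2.13 (c)] [cite: Waldspurger2003, III.1] [cite: Casselman1995, §4.4 p. 45] -/
theorem finrank_weightSpace_eq_add_of_exact (τ₁ : Representation ℂ M W₁) (τ₂ : Representation ℂ M W₂) (τ₃ : Representation ℂ M W₃) [FiniteDimensional ℂ W₂]
    (h₂ : ∀ m m' : M, Commute (τ₂ m) (τ₂ m')) (h₃ : ∀ m m' : M, Commute (τ₃ m) (τ₃ m'))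
    (f : W₁ →ₗ[ℂ] W₂) (g : W₂ →ₗ[ℂ] W₃) (hf : ∀ m v, f (τ₁ m v) = τ₂ m (f v)) (hg : ∀ m v, g (τ₂ m v) = τ₃ m (g v))
    (hinj : Injective f) (hfg : Exact f g) (hsurj : Surjective g) (χ : M → ℂ) :
    finrank ℂ ↥(⨅ m, Module.End.maxGenEigenspace (τ₂ m) (χ m)) =
      finrank ℂ ↥(⨅ m, Module.End.maxGenEigenspace (τ₁ m) (χ m)) + finrank ℂ ↥(⨅ m, Module.End.maxGenEigenspace (τ₃ m) (χ m)) := by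
  set E₂ : Submodule ℂ W₂ := ⨅ m, Module.End.maxGenEigenspace (τ₂ m) (χ m) with hE₂
  -- the restriction of `g` to `E₂`
  let g' : E₂ →ₗ[ℂ] W₃ := g ∘ₗ E₂.subtype
  have hrange : LinearMap.range g' = ⨅ m, Module.End.maxGenEigenspace (τ₃ m) (χ m) := by
    rw [LinearMap.range_comp, Submodule.range_subtype, hE₂]
    exact map_weightSpace_eq_of_surjective τ₂ τ₃ h₂ h₃ g hg hsurj χ
  have hker : LinearMap.ker g' = Submodule.comap E₂.subtype ((⨅ m, Module.End.maxGenEigenspace (τ₁ m) (χ m)).map f) := by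
    rw [LinearMap.ker_comp, ← weightSpace_inf_ker_eq_map τ₁ τ₂ τ₃ f g hf hinj hfg χ, Submodule.comap_inf, Submodule.comap_subtype_self, top_inf_eq]
  -- `ker g' ≅ (W₁)_χ` via the injective `f`
  have hkerrank : finrank ℂ ↥(LinearMap.ker g') = finrank ℂ ↥(⨅ m, Module.End.maxGenEigenspace (τ₁ m) (χ m)) := by
    rw [hker]
    have hle : (⨅ m, Module.End.maxGenEigenspace (τ₁ m) (χ m)).map f ≤ E₂ := map_weightSpace_le τ₁ τ₂ f hf χ
    rw [LinearEquiv.finrank_eq (Submodule.comapSubtypeEquivOfLe hle)]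
    exact (LinearEquiv.finrank_eq (Submodule.equivMapOfInjective f hinj _)).symm
  have hrn := LinearMap.finrank_range_add_finrank_ker g'
  rw [hrange, hkerrank] at hrn
  rw [← hrn, add_comm]

/-- Multiplicities do not increase under an INJECTIVE equivariant map into a finite-dimensional representation. [cite: BernsteinZelevinsky1977, §2.3] -/
theorem finrank_weightSpace_le_of_injective (τ₁ : Representation ℂ M W₁) (τ₂ : Representation ℂ M W₂) [FiniteDimensional ℂ W₂]
    (f : W₁ →ₗ[ℂ] W₂) (hf : ∀ m v, f (τ₁ m v) = τ₂ m (f v)) (hinj : Injective f) (χ : M → ℂ) :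
    finrank ℂ ↥(⨅ m, Module.End.maxGenEigenspace (τ₁ m) (χ m)) ≤ finrank ℂ ↥(⨅ m, Module.End.maxGenEigenspace (τ₂ m) (χ m)) := by
  calc finrank ℂ ↥(⨅ m, Module.End.maxGenEigenspace (τ₁ m) (χ m))
      = finrank ℂ ↥((⨅ m, Module.End.maxGenEigenspace (τ₁ m) (χ m)).map f) := (LinearEquiv.finrank_eq (Submodule.equivMapOfInjective f hinj _))
    _ ≤ finrank ℂ ↥(⨅ m, Module.End.maxGenEigenspace (τ₂ m) (χ m)) := Submodule.finrank_mono (map_weightSpace_le τ₁ τ₂ f hf χ)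

/-- Multiplicities do not increase under a SURJECTIVE equivariant map from a finite-dimensional representation (pairwise commuting actions).
[cite: BernsteinZelevinsky1977, §2.3] -/
theorem finrank_weightSpace_le_of_surjective (τ₁ : Representation ℂ M W₁) (τ₂ : Representation ℂ M W₂) [FiniteDimensional ℂ W₁]
    (h₁ : ∀ m m' : M, Commute (τ₁ m) (τ₁ m')) (h₂ : ∀ m m' : M, Commute (τ₂ m) (τ₂ m'))
    (g : W₁ →ₗ[ℂ] W₂) (hg : ∀ m v, g (τ₁ m v) = τ₂ m (g v)) (hsurj : Surjective g) (χ : M → ℂ) :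
    finrank ℂ ↥(⨅ m, Module.End.maxGenEigenspace (τ₂ m) (χ m)) ≤ finrank ℂ ↥(⨅ m, Module.End.maxGenEigenspace (τ₁ m) (χ m)) := by
  rw [← map_weightSpace_eq_of_surjective τ₁ τ₂ h₁ h₂ g hg hsurj χ]
  exact Submodule.finrank_map_le _ _

/-- Multiplicities are invariant under an equivariant linear ISOMORPHISM (no commutativity needed). [cite: BernsteinZelevinsky1977, §2.3] -/
theorem finrank_weightSpace_eq_of_linearEquiv (τ₁ : Representation ℂ M W₁) (τ₂ : Representation ℂ M W₂)
    (e : W₁ ≃ₗ[ℂ] W₂) (he : ∀ m v, e (τ₁ m v) = τ₂ m (e v)) (χ : M → ℂ) :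
    finrank ℂ ↥(⨅ m, Module.End.maxGenEigenspace (τ₁ m) (χ m)) = finrank ℂ ↥(⨅ m, Module.End.maxGenEigenspace (τ₂ m) (χ m)) := by
  have hmap : (⨅ m, Module.End.maxGenEigenspace (τ₁ m) (χ m)).map (e : W₁ →ₗ[ℂ] W₂) = ⨅ m, Module.End.maxGenEigenspace (τ₂ m) (χ m) := by
    refine le_antisymm (map_weightSpace_le τ₁ τ₂ (e : W₁ →ₗ[ℂ] W₂) he χ) fun z hz => ?_
    refine ⟨e.symm z, ?_, by simp⟩
    change e.symm z ∈ ⨅ m, Module.End.maxGenEigenspace (τ₁ m) (χ m)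
    rw [mem_weightSpace_iff_of_injective τ₁ τ₂ (e : W₁ →ₗ[ℂ] W₂) he e.injective χ]
    simpa using hz
  rw [← hmap]
  exact LinearEquiv.finrank_eq (Submodule.equivMapOfInjective (e : W₁ →ₗ[ℂ] W₂) e.injective _)

/-- If every weight space vanishes, a finite-dimensional `W` (pairwise commuting action) is zero. [folklore] -/
theorem subsingleton_of_forall_weightSpace_eq_bot (τ : Representation ℂ M W) [FiniteDimensional ℂ W] (hτ : ∀ m m' : M, Commute (τ m) (τ m'))
    (h : ∀ χ : M → ℂ, (⨅ m, Module.End.maxGenEigenspace (τ m) (χ m)) = ⊥) : Subsingleton W := by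
  have htop := iSup_weightSpace_eq_top τ hτ
  simp only [h, iSup_bot] at htop
  exact (Submodule.subsingleton_iff ℂ).1 (subsingleton_of_bot_eq_top htop)

end Summit.HodgeConjecture.HodgeConjecture.Cruxes.H413.K2E3JacquetExponentMultiset
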